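import Mathlib
import Literature.Geometry.Lorentzian.KerrConvergence
import Literature.Geometry.Manifold.OpenSubmanifoldMFDeriv

/-!
# Route StarvedNecks — crux `NecksCertify`, line `bargmann-small-late-exterior`: seam rung SFR

Stub `stub_seamFlatRestrict` (statement `SeamFlatRestrict` of the line skeleton, verbatim):
restricting a late flat chart `Φ : U → M` on the Minkowski background over an open `U ⊆ E4`
along the inclusion of a smaller open `U' ≤ U` (and to a later starting time `τ₀' ≥ τ₀`) gives
again a late flat chart; the differential, hence the metric deviation, is unchanged pointwise
(the differential of the inclusion of an open submanifold is the identity,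
`OpenSubmanifold.mfderiv_subtype_val`); the two extended deviations agree on the open set `U'`,
so all their iterated derivatives agree there (locality of `iteratedFDeriv`) and every `Cᵏ` sup
norm over a subset of `U'` is the same for both charts; the slab `Cᵏ` deviations can only
decrease (`supCkENorm_mono` along `{x ∈ U' | x⁰ = τ} ⊆ {x ∈ U | x⁰ = τ}`).

Mathlib + the `KerrConvergence` API + `OpenSubmanifoldMFDeriv`; no named facts.
-/

noncomputable section

open scoped Manifold ContDiff Topology ENNReal
open Filter Set MeasureTheory Topology Literature.Geometry.Lorentzian

namespace Summit.FinalStateConjecture.FinalStateConjecture.Theorems.NecksCertifyBargmann.FlatRestrict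

open TopologicalSpace Literature.Geometry.Manifold

/-- The inclusion of open subsets `U' ≤ U` of `E4` has identity differential (chain rule along
`U' → U → E4`, both inclusions into `E4` having identity differential,
`OpenSubmanifold.mfderiv_subtype_val`; Lee 2013, Prop. 3.9). [folklore] -/
theorem mfderiv_inclusion_eq_id {U U' : Opens E4} (hU : U' ≤ U) (y : U') :
    mfderiv 𝓘(ℝ, E4) 𝓘(ℝ, E4) (Opens.inclusion hU) y = ContinuousLinearMap.id ℝ E4 := by
  have hc := mfderiv_comp y
    (OpenSubmanifold.hasMFDerivAt_subtype_val (I := 𝓘(ℝ, E4))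
      (Opens.inclusion hU y)).mdifferentiableAt
    ((contMDiff_inclusion (I := 𝓘(ℝ, E4)) (n := 1) hU y).mdifferentiableAt one_ne_zero)
  change mfderiv 𝓘(ℝ, E4) 𝓘(ℝ, E4) (Subtype.val : U' → E4) y = _ at hc
  rw [OpenSubmanifold.mfderiv_subtype_val, OpenSubmanifold.mfderiv_subtype_val] at hc
  rw [← ContinuousLinearMap.id_comp (mfderiv 𝓘(ℝ, E4) 𝓘(ℝ, E4) (Opens.inclusion hU) y)]
  exact hc.symm

/-- **Chain rule for the restriction to a smaller open subset of `E4`**: the differential of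
`Φ ∘ inclusion` at `y ∈ U'` is the differential of `Φ : U → M` at `y` (`d(inclusion) = id`).
[folklore] -/
theorem mfderiv_comp_inclusion_eq {M : Type*} [TopologicalSpace M]
    [ChartedSpace (EuclideanSpace ℝ (Fin 4)) M] {U U' : Opens E4} (hU : U' ≤ U) {Φ : U → M}
    {y : U'} (hΦ : MDifferentiableAt 𝓘(ℝ, E4) (𝓡 4) Φ (Opens.inclusion hU y)) :
    mfderiv 𝓘(ℝ, E4) (𝓡 4) (Φ ∘ Opens.inclusion hU) y =
      mfderiv 𝓘(ℝ, E4) (𝓡 4) Φ (Opens.inclusion hU y) := by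
  rw [mfderiv_comp y hΦ ((contMDiff_inclusion (n := 1) hU y).mdifferentiableAt one_ne_zero),
    mfderiv_inclusion_eq_id]
  exact ContinuousLinearMap.comp_id _

/-- **Open embeddings of late regions restrict to smaller domains and later times** (Minkowski
backgrounds, time `x⁰`): if `Φ : U → M` is an open embedding of `{x ∈ U | τ₀ < x⁰}`, `U' ≤ U`
and `τ₀ ≤ τ₀'`, then `Φ ∘ inclusion` is an open embedding of `{x ∈ U' | τ₀' < x⁰}` (the
inclusion of the smaller late region into the larger is an open embedding,
`IsOpenEmbedding.of_comp` along the two open embeddings into `E4`). [folklore] -/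
theorem isOpenEmbedding_restrict_lateRegion {M : Type*} [TopologicalSpace M] {U U' : Opens E4}
    (hU : U' ≤ U) {τ₀ τ₀' : ℝ} (hτ : τ₀ ≤ τ₀') {Φ : U → M}
    (hΦ : IsOpenEmbedding (((Minkowski.backgroundOn U).lateRegion τ₀).restrict Φ)) :
    IsOpenEmbedding (((Minkowski.backgroundOn U').lateRegion τ₀').restrict
      (Φ ∘ Opens.inclusion hU)) := by
  have hc0 : Continuous fun y : E4 ↦ y 0 := PiLp.continuous_apply 2 _ 0
  have hL : IsOpen ((Minkowski.backgroundOn U).lateRegion τ₀) :=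
    isOpen_lt continuous_const (hc0.comp continuous_subtype_val)
  have hL' : IsOpen ((Minkowski.backgroundOn U').lateRegion τ₀') :=
    isOpen_lt continuous_const (hc0.comp continuous_subtype_val)
  have hsub : ∀ x : (Minkowski.backgroundOn U').lateRegion τ₀',
      Opens.inclusion hU x.1 ∈ (Minkowski.backgroundOn U).lateRegion τ₀ := fun x ↦ by
    have hx : τ₀' < x.1.1 0 := x.2
    exact lt_of_le_of_lt hτ hx
  let j : (Minkowski.backgroundOn U').lateRegion τ₀' → (Minkowski.backgroundOn U).lateRegion τ₀ :=
    fun x ↦ ⟨Opens.inclusion hU x.1, hsub x⟩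
  have hg : IsOpenEmbedding
      (fun x : (Minkowski.backgroundOn U).lateRegion τ₀ ↦ (x.1.1 : E4)) :=
    U.2.isOpenEmbedding_subtypeVal.comp hL.isOpenEmbedding_subtypeVal
  have hg' : IsOpenEmbedding
      (fun x : (Minkowski.backgroundOn U').lateRegion τ₀' ↦ (x.1.1 : E4)) :=
    U'.2.isOpenEmbedding_subtypeVal.comp hL'.isOpenEmbedding_subtypeVal
  have hj : IsOpenEmbedding j := IsOpenEmbedding.of_comp j hg hg'
  exact hΦ.comp hj

/-- **SFR — restricting the flat chart to a smaller open domain** (registered stub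
`stub_seamFlatRestrict`, statement `SeamFlatRestrict` of the line skeleton, verbatim).  For open
`U' ≤ U ⊆ E4`, a late flat chart `Φ` on `U` (Minkowski background, `IsLateChart` into `O` after
`τ₀`) restricts along `Opens.inclusion` to a late flat chart on `U'` after any `τ₀' ≥ τ₀`; the
differential and the metric deviation are unchanged pointwise, every `Cᵏ` sup norm of the
extended deviation over a subset of `U'` is the same for both charts (locality of
`iteratedFDeriv` on the open set `U'`), and the slab deviations can only decrease.
DHRT arXiv:2104.08222, §1 (late-time charts); Lee 2013, Prop. 3.9 (`T_p U = T_p M`).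
[folklore] -/
theorem stub_seamFlatRestrict :
  ∀ (𝓢 : Spacetime.{0} 4) (O : Set 𝓢.carrier) (U U' : TopologicalSpace.Opens E4) (hU : U' ≤ U)
    (τ₀ τ₀' : ℝ) (Φ : U → 𝓢.carrier), τ₀ ≤ τ₀' →
    𝓢.IsLateChart (Minkowski.backgroundOn U) O τ₀ Φ →
    𝓢.IsLateChart (Minkowski.backgroundOn U') O τ₀' (Φ ∘ TopologicalSpace.Opens.inclusion hU) ∧
    (∀ y : U', mfderiv 𝓘(ℝ, E4) (𝓡 4) (Φ ∘ TopologicalSpace.Opens.inclusion hU) y =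
      mfderiv 𝓘(ℝ, E4) (𝓡 4) Φ (TopologicalSpace.Opens.inclusion hU y)) ∧
    (∀ y : U', 𝓢.deviation (Minkowski.backgroundOn U') (Φ ∘ TopologicalSpace.Opens.inclusion hU) y =
      𝓢.deviation (Minkowski.backgroundOn U) Φ (TopologicalSpace.Opens.inclusion hU y)) ∧
    (∀ (k : ℕ) (S : Set U'), supCkENorm (Subtype.val '' S) k
        (𝓢.deviationExtend (Minkowski.backgroundOn U') (Φ ∘ TopologicalSpace.Opens.inclusion hU)) =
      supCkENorm (Subtype.val '' S) k (𝓢.deviationExtend (Minkowski.backgroundOn U) Φ)) ∧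
    (∀ (k : ℕ) (τ : ℝ), 𝓢.deviationCk (Minkowski.backgroundOn U') (Φ ∘ TopologicalSpace.Opens.inclusion hU) k τ ≤
      𝓢.deviationCk (Minkowski.backgroundOn U) Φ k τ) := by
  intro 𝓢 O U U' hU τ₀ τ₀' Φ hτ hΦ
  -- (2) the differential is unchanged (`d(inclusion) = id`)
  have h2 : ∀ y : U', mfderiv 𝓘(ℝ, E4) (𝓡 4) (Φ ∘ Opens.inclusion hU) y =
      mfderiv 𝓘(ℝ, E4) (𝓡 4) Φ (Opens.inclusion hU y) := fun y ↦
    mfderiv_comp_inclusion_eq hU ((hΦ.contMDiff _).mdifferentiableAt (by simp))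
  -- (3) hence the deviation is unchanged (both reference fields are `η`)
  have h3 : ∀ y : U',
      𝓢.deviation (Minkowski.backgroundOn U') (Φ ∘ Opens.inclusion hU) y =
        𝓢.deviation (Minkowski.backgroundOn U) Φ (Opens.inclusion hU y) := fun y ↦ by
    refine ContinuousLinearMap.ext fun v ↦ ContinuousLinearMap.ext fun w ↦ ?_
    rw [Spacetime.deviation_apply, Spacetime.deviation_apply]
    exact congrArg (fun L : E4 →L[ℝ] TangentSpace (𝓡 4) (Φ (Opens.inclusion hU y)) ↦
      𝓢.metric.val (Φ (Opens.inclusion hU y)) (L v) (L w) - Minkowski.bilin v w) (h2 y)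
  -- the two extensions by zero agree on the open set `U'`, hence so do all their derivatives
  have hpt : ∀ x : U',
      𝓢.deviationExtend (Minkowski.backgroundOn U') (Φ ∘ Opens.inclusion hU) x =
        𝓢.deviationExtend (Minkowski.backgroundOn U) Φ x := fun x ↦
    (𝓢.deviationExtend_coe (Minkowski.backgroundOn U') (Φ ∘ Opens.inclusion hU) x).trans
      ((h3 x).trans
        (𝓢.deviationExtend_coe (Minkowski.backgroundOn U) Φ (Opens.inclusion hU x)).symm)
  have hev : ∀ x : U',
      𝓢.deviationExtend (Minkowski.backgroundOn U') (Φ ∘ Opens.inclusion hU) =ᶠ[𝓝 (x : E4)]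
        𝓢.deviationExtend (Minkowski.backgroundOn U) Φ := fun x ↦ by
    filter_upwards [U'.isOpen.mem_nhds x.2] with y hy
    exact hpt ⟨y, hy⟩
  have hit : ∀ (m : ℕ) (x : U'),
      iteratedFDeriv ℝ m
          (𝓢.deviationExtend (Minkowski.backgroundOn U') (Φ ∘ Opens.inclusion hU)) x =
        iteratedFDeriv ℝ m (𝓢.deviationExtend (Minkowski.backgroundOn U) Φ) x :=
    fun m x ↦ ((hev x).iteratedFDeriv ℝ m).eq_of_nhds
  -- (4) every `Cᵏ` sup norm over a subset of `U'` is the same for both charts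
  have h4 : ∀ (k : ℕ) (S : Set U'), supCkENorm (Subtype.val '' S) k
        (𝓢.deviationExtend (Minkowski.backgroundOn U') (Φ ∘ Opens.inclusion hU)) =
      supCkENorm (Subtype.val '' S) k (𝓢.deviationExtend (Minkowski.backgroundOn U) Φ) := by
    intro k S
    simp only [supCkENorm]
    refine iSup_congr fun m ↦ iSup_congr fun _ ↦ iSup_congr fun x ↦ iSup_congr fun hx ↦ ?_
    obtain ⟨y, -, rfl⟩ := hx
    rw [hit m y]
  -- (5) the slab deviations can only decrease
  have h5 : ∀ (k : ℕ) (τ : ℝ),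
      𝓢.deviationCk (Minkowski.backgroundOn U') (Φ ∘ Opens.inclusion hU) k τ ≤
        𝓢.deviationCk (Minkowski.backgroundOn U) Φ k τ := by
    intro k τ
    show supCkENorm (Subtype.val '' (Minkowski.backgroundOn U').timeSlab τ) k
        (𝓢.deviationExtend (Minkowski.backgroundOn U') (Φ ∘ Opens.inclusion hU)) ≤
      supCkENorm (Subtype.val '' (Minkowski.backgroundOn U).timeSlab τ) k
        (𝓢.deviationExtend (Minkowski.backgroundOn U) Φ)
    refine (h4 k _).le.trans (supCkENorm_mono ?_ _ _)
    rintro _ ⟨y, hy, rfl⟩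
    exact ⟨Opens.inclusion hU y, hy, rfl⟩
  -- (1) the restriction is again a late flat chart
  have h1 : 𝓢.IsLateChart (Minkowski.backgroundOn U') O τ₀' (Φ ∘ Opens.inclusion hU) := by
    refine ⟨hΦ.contMDiff.comp (contMDiff_inclusion hU),
      isOpenEmbedding_restrict_lateRegion hU hτ hΦ.isOpenEmbedding, ?_⟩
    rintro _ ⟨x, hx, rfl⟩
    have hx' : τ₀' < x.1 0 := hx
    exact hΦ.image_subset ⟨Opens.inclusion hU x, lt_of_le_of_lt hτ hx', rfl⟩
  exact ⟨h1, h2, h3, h4, h5⟩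

end Summit.FinalStateConjecture.FinalStateConjecture.Theorems.NecksCertifyBargmann.FlatRestrict

end
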